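import Summits.BirchSwinnertonDyer.BirchSwinnertonDyer.Theorems.AlignedTransportAtTwoMainConjectureTransportAlignedAtTwoDepletedPeriodFormula
import HarnessLib

/-!
# Crux C1 `MainConjectureTransportAlignedAtTwo` (stmt-BirchSwinnertonDyer-22296), line `birth`, residual (R2) `stub_lamLawKilford` (Kilford stratum),
# UNEQUAL conductors — TOOLS for the intermediate-level reduction: the action of Euler depletion products MODULO `2Λ`, dilated cusps,
# the cycle computing an integer operator, and the `q`-old line `F = f + q·f(q·)` (width seat att-p3 g18; `--supports 22296`)

THEOREMS ONLY (no `def`, no `sorry`, no named fact). Pure algebra of finite sums and period bookkeeping on the tree's modular symbols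
`{∞, r}_h` (`modularSymbol`), period homology `H₁(X₀(N);ℤ)` (`periodHomology`), degeneracy maps `ι_d` (`iota`) and the monoid-algebra
action `(D·ψ)(x) = ∑ a_m ψ(m x)` of cell bsd-wall (`…ThetaLayerLambdaCongruenceAtTwoDepletedHeckeAlgebra`, written
`D.coeff.sum (fun m a ↦ a * ψ (m x))`). Nothing about any curve, Galois representation or `L`-function is asserted; BSD is not proved by this;
C1 is not closed by this. Consumer: `…KilfordCopyCrossLevel` (the reduction of the cross-level same-kernel statement of (R2) for
`N₂ = q·N₁` to the intermediate level `N₂`).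

* §1 `act_factor_mul` (one depletion factor times an operator), `mul_act_prod_int_mem` (an INTEGER-coefficient product
  `∏([1] + B_ℓ[ℓ] + E_ℓ[ℓ²])` maps `ψ` with `c·ψ(m r) ∈ Λ` (`m ∣ ∏ℓ²`) to `Λ`), **`mul_act_prod_congr_mod_two`**: for ODD `ℓ ∈ S` and the
  Euler factors `[1] + (B_ℓ/ℓ)[ℓ] + (E_ℓ/ℓ)[ℓ²]` of the depleted period formula, `c·∏ℓ²·(∏D_ℓ·ψ)(r) ≡ c·(∏D̄_ℓ·ψ)(r) (mod 2Λ)` for ANY integer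
  data `D̄_ℓ = [1] + B'_ℓ[ℓ] + E'_ℓ[ℓ²]` with `B'_ℓ ≡ B_ℓ`, `E'_ℓ ≡ E_ℓ (mod 2)` (an odd integer acts as `1` on `Λ/2Λ`); `act_oldLine`
  (`D·(ψ + ψ∘[q])(x) = (D·ψ)(x) + (D·ψ)(qx)`); `div_two_mem_iff_of_eq_add`.
* §2 `exists_gamma0_dilate_cusp` (`d·γ∞` is a `Γ₀(K)`-translate of `∞` when `K d ∣ N'`), **`exists_mem_periodHomology_apply_eq_act`**: an integer
  operator evaluated on `{∞, ·}_H` at admissible `r` is `y(H)` for ONE cycle `y ∈ H₁(X₀(K);ℤ)` and every `H ∈ S₂(Γ₀(K))`.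
* §3 `exists_oldLine`, **`modularSymbol_oldLine`**: the old line `F = f + q·ι_q f ∈ S₂(Γ₀(N₁q))` (`a_n(F) = a_n(f) + q a_{n/q}(f)`) has
  `{∞, s}_F = {∞, s}_f + {∞, q s}_f`.

References: Greenberg–Vatsal 2000 §3 [GreenbergVatsal2000]; Emerton–Pollack–Weston 2006 §3 (3.4)–(3.5) [EmertonPollackWeston2006];
Cremona 1997 §2.2, §2.4 [CremonaAlgorithms1997]; Diamond–Shurman §5.7 [DiamondShurman2005].
-/

noncomputable section

-- justification: the `Summit.BirchSwinnertonDyer.BirchSwinnertonDyer.…` path repeats a component (route-file convention)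
set_option linter.dupNamespace false
set_option autoImplicit false

open scoped MatrixGroups ModularForm Classical

open CongruenceSubgroup Complex
open Literature.NumberTheory.EllipticCurves Literature.NumberTheory.EllipticCurves.ModularForms
open Summit.BirchSwinnertonDyer.BirchSwinnertonDyer.Theorems.ThetaLayerLambdaCongruenceAtTwo
open Summit.BirchSwinnertonDyer.BirchSwinnertonDyer.Theorems.AlignedTransportAtTwoDepletedPeriodFormula
open Summit.BirchSwinnertonDyer.BirchSwinnertonDyer.Theorems.MazurTateCongruenceAtTwoR.DepletedLattice (modularSymbol_iota)

namespace Summit.BirchSwinnertonDyer.BirchSwinnertonDyer.Theorems.AlignedTransportAtTwoKilfordCopyCrossLevelTools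

/-! ## §1 Generic algebra: integer-coefficient products of depletion factors acting on a function with values in a lattice -/

/-- One depletion factor times an operator `P`: `(([1] + c₁[ℓ] + c₂[ℓ²])·P)·ψ (x) = (P·ψ)(x) + c₁ (P·ψ)(ℓx) + c₂ (P·ψ)(ℓ²x)`. [folklore] -/
theorem act_factor_mul (ψ : ℚ → ℂ) (ℓ : ℕ) (c₁ c₂ : ℂ) (P : MonoidAlgebra ℂ ℕ) (x : ℚ) :
    (((MonoidAlgebra.single 1 (1 : ℂ) + MonoidAlgebra.single ℓ c₁ + MonoidAlgebra.single (ℓ ^ 2) c₂) * P :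
        MonoidAlgebra ℂ ℕ).coeff.sum fun m a ↦ a * ψ ((m : ℚ) * x)) =
      (P.coeff.sum fun m a ↦ a * ψ ((m : ℚ) * x)) + c₁ * (P.coeff.sum fun m a ↦ a * ψ ((m : ℚ) * ((ℓ : ℚ) * x))) +
        c₂ * (P.coeff.sum fun m a ↦ a * ψ ((m : ℚ) * (((ℓ ^ 2 : ℕ) : ℚ) * x))) := by
  rw [act_mul]
  exact act_depletionFactor (fun s ↦ P.coeff.sum fun m a ↦ a * ψ ((m : ℚ) * s)) ℓ c₁ c₂ x

/-- **Integrality of the action of an integer-coefficient depletion product.** If `c·ψ(m·r) ∈ Λ` for every `m ∣ ∏_{ℓ∈S} ℓ²`, then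
`c·((∏_{ℓ∈S} ([1] + B_ℓ[ℓ] + E_ℓ[ℓ²]))·ψ)(r) ∈ Λ` for integers `B_ℓ, E_ℓ`. [folklore] -/
theorem mul_act_prod_int_mem (Λ : AddSubgroup ℂ) (ψ : ℚ → ℂ) (c : ℂ) (B E : ℕ → ℤ) (S : Finset ℕ) :
    ∀ (r : ℚ), (∀ m : ℕ, m ∣ ∏ ℓ ∈ S, ℓ ^ 2 → c * ψ ((m : ℚ) * r) ∈ Λ) →
      c * ((∏ ℓ ∈ S, (MonoidAlgebra.single 1 (1 : ℂ) + MonoidAlgebra.single ℓ ((B ℓ : ℤ) : ℂ) +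
          MonoidAlgebra.single (ℓ ^ 2) ((E ℓ : ℤ) : ℂ)) : MonoidAlgebra ℂ ℕ).coeff.sum
        fun m a ↦ a * ψ ((m : ℚ) * r)) ∈ Λ := by
  classical
  induction S using Finset.induction_on with
  | empty =>
    intro r hΛ
    rw [Finset.prod_empty, MonoidAlgebra.one_def, act_single, one_mul]
    simpa only [Finset.prod_empty, Nat.cast_one] using hΛ 1 (by simp)
  | insert ℓ S hℓS ih =>
    intro r hΛ
    have hsub : ∀ (j : ℕ), j ≤ 2 → ∀ m : ℕ, m ∣ ∏ ℓ' ∈ S, ℓ' ^ 2 →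
        c * ψ ((m : ℚ) * (((ℓ ^ j : ℕ) : ℚ) * r)) ∈ Λ := by
      intro j hj m hm
      have h := hΛ (m * ℓ ^ j) (by
        rw [Finset.prod_insert hℓS]
        exact mul_comm (ℓ ^ 2) _ ▸ mul_dvd_mul hm (pow_dvd_pow ℓ hj))
      simpa only [Nat.cast_mul, mul_assoc] using h
    have h0 := ih r (by simpa only [pow_zero, Nat.cast_one, one_mul] using hsub 0 (by norm_num))
    have h1 := ih ((ℓ : ℚ) * r) (by simpa only [pow_one] using hsub 1 (by norm_num))
    have h2 := ih (((ℓ ^ 2 : ℕ) : ℚ) * r) (hsub 2 le_rfl)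
    rw [Finset.prod_insert hℓS, act_factor_mul, mul_add, mul_add, mul_left_comm c ((B ℓ : ℤ) : ℂ),
      mul_left_comm c ((E ℓ : ℤ) : ℂ)]
    refine Λ.add_mem (Λ.add_mem h0 ?_) ?_
    · rw [← zsmul_eq_mul]; exact Λ.zsmul_mem h1 _
    · rw [← zsmul_eq_mul]; exact Λ.zsmul_mem h2 _

/-- The ring identity behind the induction step of `mul_act_prod_congr_mod_two`. [folklore] -/
theorem congr_step_identity (c M l u v B E B' E' k₀ k₁ k₂ X₀ X₁ X₂ Y₀ Y₁ Y₂ z₀ z₁ z₂ : ℂ)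
    (h0 : c * M * X₀ = c * Y₀ + 2 * z₀) (h1 : c * M * X₁ = c * Y₁ + 2 * z₁) (h2 : c * M * X₂ = c * Y₂ + 2 * z₂)
    (hu : l * u = B) (hv : l * v = E) (hk₀ : l ^ 2 - 1 = 2 * k₀) (hk₁ : l * B - B' = 2 * k₁) (hk₂ : l * E - E' = 2 * k₂) :
    c * (l ^ 2 * M) * (X₀ + u * X₁ + v * X₂) =
      c * (Y₀ + B' * Y₁ + E' * Y₂) +
        2 * (k₀ * (c * Y₀) + k₁ * (c * Y₁) + k₂ * (c * Y₂) + l ^ 2 * z₀ + l * B * z₁ + l * E * z₂) := by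
  linear_combination l ^ 2 * h0 + l * B * h1 + l * E * h2 + c * M * l * X₁ * hu + c * M * l * X₂ * hv +
    c * Y₀ * hk₀ + c * Y₁ * hk₁ + c * Y₂ * hk₂

/-- **The action of a depletion product with ODD primes, modulo `2Λ`.** For `ℓ ∈ S` odd, rational coefficients `u_ℓ = B_ℓ/ℓ`,
`v_ℓ = E_ℓ/ℓ` with `B_ℓ, E_ℓ ∈ ℤ`, and integers `B'_ℓ ≡ B_ℓ`, `E'_ℓ ≡ E_ℓ (mod 2)`: if `c·ψ(m·r) ∈ Λ` for all `m ∣ ∏ℓ²`, then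
`c·∏ℓ²·((∏([1] + u_ℓ[ℓ] + v_ℓ[ℓ²]))·ψ)(r) ≡ c·((∏([1] + B'_ℓ[ℓ] + E'_ℓ[ℓ²]))·ψ)(r) (mod 2Λ)` — an odd integer acts as `1` on `Λ/2Λ`.
[folklore] -/
theorem mul_act_prod_congr_mod_two (Λ : AddSubgroup ℂ) (ψ : ℚ → ℂ) (c : ℂ) (u v : ℕ → ℂ) (B E B' E' : ℕ → ℤ)
    (S : Finset ℕ) (hodd : ∀ ℓ ∈ S, Odd ℓ)
    (hu : ∀ ℓ ∈ S, (ℓ : ℂ) * u ℓ = B ℓ) (hv : ∀ ℓ ∈ S, (ℓ : ℂ) * v ℓ = E ℓ)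
    (hB : ∀ ℓ ∈ S, (2 : ℤ) ∣ B ℓ - B' ℓ) (hE : ∀ ℓ ∈ S, (2 : ℤ) ∣ E ℓ - E' ℓ) :
    ∀ (r : ℚ), (∀ m : ℕ, m ∣ ∏ ℓ ∈ S, ℓ ^ 2 → c * ψ ((m : ℚ) * r) ∈ Λ) →
      ∃ z ∈ Λ, c * ((∏ ℓ ∈ S, ℓ ^ 2 : ℕ) : ℂ) *
          ((∏ ℓ ∈ S, (MonoidAlgebra.single 1 (1 : ℂ) + MonoidAlgebra.single ℓ (u ℓ) +
              MonoidAlgebra.single (ℓ ^ 2) (v ℓ)) : MonoidAlgebra ℂ ℕ).coeff.sum fun m a ↦ a * ψ ((m : ℚ) * r)) =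
        c * ((∏ ℓ ∈ S, (MonoidAlgebra.single 1 (1 : ℂ) + MonoidAlgebra.single ℓ ((B' ℓ : ℤ) : ℂ) +
              MonoidAlgebra.single (ℓ ^ 2) ((E' ℓ : ℤ) : ℂ)) : MonoidAlgebra ℂ ℕ).coeff.sum fun m a ↦ a * ψ ((m : ℚ) * r)) +
          2 * z := by
  classical
  induction S using Finset.induction_on with
  | empty =>
    intro r _
    refine ⟨0, Λ.zero_mem, ?_⟩
    simp only [Finset.prod_empty, MonoidAlgebra.one_def, act_single, Nat.cast_one, one_mul, mul_one, mul_zero, add_zero]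
  | insert ℓ S hℓS ih =>
    intro r hΛ
    have hoddS : ∀ ℓ' ∈ S, Odd ℓ' := fun ℓ' h ↦ hodd ℓ' (Finset.mem_insert_of_mem h)
    have huS : ∀ ℓ' ∈ S, (ℓ' : ℂ) * u ℓ' = B ℓ' := fun ℓ' h ↦ hu ℓ' (Finset.mem_insert_of_mem h)
    have hvS : ∀ ℓ' ∈ S, (ℓ' : ℂ) * v ℓ' = E ℓ' := fun ℓ' h ↦ hv ℓ' (Finset.mem_insert_of_mem h)
    have hBS : ∀ ℓ' ∈ S, (2 : ℤ) ∣ B ℓ' - B' ℓ' := fun ℓ' h ↦ hB ℓ' (Finset.mem_insert_of_mem h)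
    have hES : ∀ ℓ' ∈ S, (2 : ℤ) ∣ E ℓ' - E' ℓ' := fun ℓ' h ↦ hE ℓ' (Finset.mem_insert_of_mem h)
    have hsub : ∀ (j : ℕ), j ≤ 2 → ∀ m : ℕ, m ∣ ∏ ℓ' ∈ S, ℓ' ^ 2 →
        c * ψ ((m : ℚ) * (((ℓ ^ j : ℕ) : ℚ) * r)) ∈ Λ := by
      intro j hj m hm
      have h := hΛ (m * ℓ ^ j) (by
        rw [Finset.prod_insert hℓS]
        exact mul_comm (ℓ ^ 2) _ ▸ mul_dvd_mul hm (pow_dvd_pow ℓ hj))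
      simpa only [Nat.cast_mul, mul_assoc] using h
    have hΛ0 : ∀ m : ℕ, m ∣ ∏ ℓ' ∈ S, ℓ' ^ 2 → c * ψ ((m : ℚ) * r) ∈ Λ := by
      simpa only [pow_zero, Nat.cast_one, one_mul] using hsub 0 (by norm_num)
    have hΛ1 : ∀ m : ℕ, m ∣ ∏ ℓ' ∈ S, ℓ' ^ 2 → c * ψ ((m : ℚ) * ((ℓ : ℚ) * r)) ∈ Λ := by
      simpa only [pow_one] using hsub 1 (by norm_num)
    have hΛ2 : ∀ m : ℕ, m ∣ ∏ ℓ' ∈ S, ℓ' ^ 2 → c * ψ ((m : ℚ) * (((ℓ ^ 2 : ℕ) : ℚ) * r)) ∈ Λ := hsub 2 le_rfl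
    obtain ⟨z₀, hz₀, h0⟩ := ih hoddS huS hvS hBS hES r hΛ0
    obtain ⟨z₁, hz₁, h1⟩ := ih hoddS huS hvS hBS hES ((ℓ : ℚ) * r) hΛ1
    obtain ⟨z₂, hz₂, h2⟩ := ih hoddS huS hvS hBS hES (((ℓ ^ 2 : ℕ) : ℚ) * r) hΛ2
    -- the reduced values lie in `Λ`
    have hm0 := mul_act_prod_int_mem Λ ψ c B' E' S r hΛ0
    have hm1 := mul_act_prod_int_mem Λ ψ c B' E' S ((ℓ : ℚ) * r) hΛ1
    have hm2 := mul_act_prod_int_mem Λ ψ c B' E' S (((ℓ ^ 2 : ℕ) : ℚ) * r) hΛ2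
    -- parities (`ℓ` odd)
    obtain ⟨t, ht⟩ := hodd ℓ (Finset.mem_insert_self ℓ S)
    have htZ : (ℓ : ℤ) = 2 * t + 1 := by exact_mod_cast ht
    obtain ⟨w₁, hw₁⟩ := hB ℓ (Finset.mem_insert_self ℓ S)
    obtain ⟨w₂, hw₂⟩ := hE ℓ (Finset.mem_insert_self ℓ S)
    have hk₀ : ((ℓ : ℂ)) ^ 2 - 1 = 2 * (((2 : ℤ) * t ^ 2 + 2 * t : ℤ) : ℂ) := by
      have h : ((ℓ : ℤ) : ℂ) = (((2 : ℤ) * t + 1 : ℤ) : ℂ) := by rw [htZ]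
      push_cast at h ⊢
      rw [h]; ring
    have hk₁ : (ℓ : ℂ) * (B ℓ : ℂ) - (B' ℓ : ℂ) = 2 * (((t : ℤ) * B ℓ + w₁ : ℤ) : ℂ) := by
      have h : ((ℓ : ℤ) : ℂ) = (((2 : ℤ) * t + 1 : ℤ) : ℂ) := by rw [htZ]
      have h' : ((B ℓ - B' ℓ : ℤ) : ℂ) = ((2 * w₁ : ℤ) : ℂ) := by rw [hw₁]
      push_cast at h h' ⊢
      rw [h]; linear_combination h'
    have hk₂ : (ℓ : ℂ) * (E ℓ : ℂ) - (E' ℓ : ℂ) = 2 * (((t : ℤ) * E ℓ + w₂ : ℤ) : ℂ) := by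
      have h : ((ℓ : ℤ) : ℂ) = (((2 : ℤ) * t + 1 : ℤ) : ℂ) := by rw [htZ]
      have h' : ((E ℓ - E' ℓ : ℤ) : ℂ) = ((2 * w₂ : ℤ) : ℂ) := by rw [hw₂]
      push_cast at h h' ⊢
      rw [h]; linear_combination h'
    have huℓ := hu ℓ (Finset.mem_insert_self ℓ S)
    have hvℓ := hv ℓ (Finset.mem_insert_self ℓ S)
    have key := congr_step_identity c ((∏ ℓ' ∈ S, ℓ' ^ 2 : ℕ) : ℂ) (ℓ : ℂ) (u ℓ) (v ℓ) (B ℓ) (E ℓ) (B' ℓ) (E' ℓ)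
      _ _ _ _ _ _ _ _ _ z₀ z₁ z₂ h0 h1 h2 huℓ hvℓ hk₀ hk₁ hk₂
    refine ⟨_, ?_, by
      rw [Finset.prod_insert hℓS, Finset.prod_insert hℓS, Finset.prod_insert hℓS, act_factor_mul, act_factor_mul,
        show ((ℓ ^ 2 * ∏ ℓ' ∈ S, ℓ' ^ 2 : ℕ) : ℂ) = (ℓ : ℂ) ^ 2 * ((∏ ℓ' ∈ S, ℓ' ^ 2 : ℕ) : ℂ) by push_cast; ring]
      exact key⟩
    · refine Λ.add_mem (Λ.add_mem (Λ.add_mem (Λ.add_mem (Λ.add_mem ?_ ?_) ?_) ?_) ?_) ?_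
      · rw [← zsmul_eq_mul]; exact Λ.zsmul_mem hm0 _
      · rw [← zsmul_eq_mul]; exact Λ.zsmul_mem hm1 _
      · rw [← zsmul_eq_mul]; exact Λ.zsmul_mem hm2 _
      · rw [← Nat.cast_pow, ← nsmul_eq_mul]; exact Λ.nsmul_mem hz₀ _
      · rw [← Int.cast_natCast, ← Int.cast_mul, ← zsmul_eq_mul]; exact Λ.zsmul_mem hz₁ _
      · rw [← Int.cast_natCast, ← Int.cast_mul, ← zsmul_eq_mul]; exact Λ.zsmul_mem hz₂ _

/-- The action on the symbols of an old line: `D·(ψ + ψ∘[d]) (x) = (D·ψ)(x) + (D·ψ)(d x)`. [folklore] -/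
theorem act_oldLine (D : MonoidAlgebra ℂ ℕ) (ψ : ℚ → ℂ) (d : ℚ) (x : ℚ) :
    (D.coeff.sum fun m a ↦ a * (ψ ((m : ℚ) * x) + ψ (d * ((m : ℚ) * x)))) =
      (D.coeff.sum fun m a ↦ a * ψ ((m : ℚ) * x)) + D.coeff.sum fun m a ↦ a * ψ ((m : ℚ) * (d * x)) := by
  simp only [Finsupp.sum, mul_add, Finset.sum_add_distrib, mul_left_comm d]

/-- Halving a congruence modulo `2Λ`: if `a = b + 2z` with `z ∈ Λ` then `a/2 ∈ Λ ↔ b/2 ∈ Λ`. [folklore] -/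
theorem div_two_mem_iff_of_eq_add (Λ : AddSubgroup ℂ) {a b z : ℂ} (hz : z ∈ Λ) (h : a = b + 2 * z) :
    a / 2 ∈ Λ ↔ b / 2 ∈ Λ := by
  have hab : a / 2 = b / 2 + z := by rw [h]; ring
  rw [hab]
  exact ⟨fun hmem ↦ by simpa using Λ.sub_mem hmem hz, fun hmem ↦ Λ.add_mem hmem hz⟩

/-! ## §2 Cusps: the dilated cusp `d·γ∞` is a `Γ₀(K)`-translate of `∞`, and the action of an integer operator on `{∞, ·}_H` is a cycle -/

/-- For `γ ∈ Γ₀(N')` with `γ∞ ≠ ∞` and `K·d ∣ N'` (`d ≠ 0`), the cusp `d·γ∞` is `δ∞` for some `δ ∈ Γ₀(K)` with `δ∞ ≠ ∞`: with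
`γ∞ = a/c`, `c = d·c'`, take the first column `(a, c')`. [cite: CremonaAlgorithms1997, §2.2 Lemma 2.2.3 and §2.4] -/
theorem exists_gamma0_dilate_cusp {K N' d : ℕ} (hd : d ≠ 0) (h : K * d ∣ N') (γ : Gamma0 N')
    (hc : (γ : SL(2, ℤ)) 1 0 ≠ 0) :
    ∃ δ : Gamma0 K, (δ : SL(2, ℤ)) 1 0 ≠ 0 ∧
      (((δ : SL(2, ℤ)) 0 0 : ℚ) / ((δ : SL(2, ℤ)) 1 0 : ℚ)) =
        (d : ℚ) * ((((γ : SL(2, ℤ)) 0 0 : ℚ) / ((γ : SL(2, ℤ)) 1 0 : ℚ))) := by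
  set a : ℤ := (γ : SL(2, ℤ)) 0 0 with ha
  set c : ℤ := (γ : SL(2, ℤ)) 1 0 with hc'
  have hN'c : (N' : ℤ) ∣ c := by
    have hγ := γ.2
    rw [Gamma0_mem, ZMod.intCast_zmod_eq_zero_iff_dvd] at hγ
    exact hγ
  have hdc : (d : ℤ) ∣ c :=
    ((Int.natCast_dvd_natCast.mpr (Dvd.intro_left _ rfl : d ∣ K * d)).trans (Int.natCast_dvd_natCast.mpr h)).trans hN'c
  obtain ⟨c', hcc'⟩ := hdc
  have hd0 : (d : ℤ) ≠ 0 := by exact_mod_cast hd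
  have hc'0 : c' ≠ 0 := by
    rintro rfl
    exact hc (by rw [hcc', mul_zero])
  have hKc' : (K : ℤ) ∣ c' := by
    have h1 : ((K * d : ℕ) : ℤ) ∣ c := (Int.natCast_dvd_natCast.mpr h).trans hN'c
    rw [hcc', Nat.cast_mul, mul_comm (K : ℤ)] at h1
    exact Int.dvd_of_mul_dvd_mul_left hd0 h1
  have hcop : IsCoprime a c' := by
    have hdet := Matrix.SpecialLinearGroup.det_coe (γ : SL(2, ℤ))
    rw [Matrix.det_fin_two] at hdet
    have : IsCoprime a c := by
      refine ⟨(γ : SL(2, ℤ)) 1 1, -(γ : SL(2, ℤ)) 0 1, ?_⟩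
      rw [ha, hc']
      linear_combination hdet
    rw [hcc'] at this
    exact this.of_mul_right_right
  refine ⟨Gamma0.mkOfCol a c' hcop hKc', by rw [Gamma0.mkOfCol_apply_one_zero]; exact hc'0, ?_⟩
  rw [Gamma0.mkOfCol_apply_zero_zero, Gamma0.mkOfCol_apply_one_zero, hcc']
  push_cast
  have hc'Q : (c' : ℚ) ≠ 0 := by exact_mod_cast hc'0
  have hdQ : (d : ℚ) ≠ 0 := by exact_mod_cast hd
  field_simp

/-- **The integer operator `∏_{ℓ∈S}([1] + B_ℓ[ℓ] + E_ℓ[ℓ²])` acts on `{∞, ·}_H (r)` through ONE integral cycle**: if every dilated cusp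
`m·r`, `m ∣ ∏ℓ²`, is a `Γ₀(K)`-translate of `∞`, there is `y ∈ H₁(X₀(K);ℤ)` (the tree's `periodHomology K`) with
`y(H) = ((∏([1] + B_ℓ[ℓ] + E_ℓ[ℓ²]))·{∞, ·}_H)(r)` for EVERY `H ∈ S₂(Γ₀(K))`. [cite: CremonaAlgorithms1997, §2.4] -/
theorem exists_mem_periodHomology_apply_eq_act (K : ℕ) [NeZero K] (B E : ℕ → ℤ) (S : Finset ℕ) :
    ∀ (r : ℚ), (∀ m : ℕ, m ∣ ∏ ℓ ∈ S, ℓ ^ 2 → ∃ δ : Gamma0 K, (δ : SL(2, ℤ)) 1 0 ≠ 0 ∧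
        (((δ : SL(2, ℤ)) 0 0 : ℚ) / ((δ : SL(2, ℤ)) 1 0 : ℚ)) = (m : ℚ) * r) →
      ∃ y ∈ periodHomology K, ∀ H : CuspForm (Gamma0 K) 2,
        y H = ((∏ ℓ ∈ S, (MonoidAlgebra.single 1 (1 : ℂ) + MonoidAlgebra.single ℓ ((B ℓ : ℤ) : ℂ) +
          MonoidAlgebra.single (ℓ ^ 2) ((E ℓ : ℤ) : ℂ)) : MonoidAlgebra ℂ ℕ).coeff.sum
            fun m a ↦ a * modularSymbol H ((m : ℚ) * r)) := by
  classical
  induction S using Finset.induction_on with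
  | empty =>
    intro r hadm
    obtain ⟨δ, hδ, hδr⟩ := hadm 1 (by simp)
    refine ⟨periodFunctional K δ, periodFunctional_mem_periodHomology K δ, fun H ↦ ?_⟩
    rw [periodFunctional_apply, cuspSymbol, if_neg hδ, hδr, Finset.prod_empty, MonoidAlgebra.one_def, act_single, one_mul]
  | insert ℓ S hℓS ih =>
    intro r hadm
    have hsub : ∀ (j : ℕ), j ≤ 2 → ∀ m : ℕ, m ∣ ∏ ℓ' ∈ S, ℓ' ^ 2 → ∃ δ : Gamma0 K, (δ : SL(2, ℤ)) 1 0 ≠ 0 ∧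
        (((δ : SL(2, ℤ)) 0 0 : ℚ) / ((δ : SL(2, ℤ)) 1 0 : ℚ)) = (m : ℚ) * (((ℓ ^ j : ℕ) : ℚ) * r) := by
      intro j hj m hm
      obtain ⟨δ, hδ, hδr⟩ := hadm (m * ℓ ^ j) (by
        rw [Finset.prod_insert hℓS]
        exact mul_comm (ℓ ^ 2) _ ▸ mul_dvd_mul hm (pow_dvd_pow ℓ hj))
      exact ⟨δ, hδ, by rw [hδr]; push_cast; ring⟩
    obtain ⟨y₀, hy₀, h0⟩ := ih r (by simpa only [pow_zero, Nat.cast_one, one_mul] using hsub 0 (by norm_num))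
    obtain ⟨y₁, hy₁, h1⟩ := ih ((ℓ : ℚ) * r) (by simpa only [pow_one] using hsub 1 (by norm_num))
    obtain ⟨y₂, hy₂, h2⟩ := ih (((ℓ ^ 2 : ℕ) : ℚ) * r) (hsub 2 le_rfl)
    refine ⟨y₀ + (B ℓ) • y₁ + (E ℓ) • y₂,
      (periodHomology K).add_mem ((periodHomology K).add_mem hy₀ ((periodHomology K).zsmul_mem hy₁ _))
        ((periodHomology K).zsmul_mem hy₂ _), fun H ↦ ?_⟩
    rw [LinearMap.add_apply, LinearMap.add_apply, LinearMap.smul_apply, LinearMap.smul_apply, h0 H, h1 H, h2 H,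
      Finset.prod_insert hℓS, act_factor_mul, zsmul_eq_mul, zsmul_eq_mul]

/-! ## §3 The `q`-old line `F = f + q·f(q·)` at level `N₁q`: its modular symbols -/

/-- **The old form `F = f + q·ι_q f ∈ S₂(Γ₀(N₁q))` exists** (`a_n(F) = a_n(f) + q·a_{n/q}(f)`). Mod `2` (`q` odd) this is the
`U_q ≡ 1` old line `f + f(q·)` of `f` at level `N₁q`. [cite: DiamondShurman2005, §5.7] -/
theorem exists_oldLine {N₁ : ℕ} [NeZero N₁] (q : ℕ) [NeZero q] (f : CuspForm (Gamma0 N₁) 2) :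
    ∃ F : CuspForm (Gamma0 (N₁ * q)) 2, ∀ n : ℕ,
      cuspCoeff F n = cuspCoeff f n + (q : ℂ) * (if q ∣ n then cuspCoeff f (n / q) else 0) := by
  refine ⟨toLevel0 (dvd_mul_right N₁ q) 2 f + (q : ℂ) • iota N₁ (N₁ * q) q 2 dvd_rfl f, fun n ↦ ?_⟩
  simp only [cuspCoeff, qExpansion_coeff_add_level0, qExpansion_toLevel0, qExpansion_coeff_smul, qExpansion_coeff_iota]

/-- **Modular symbols of the old line**: if `a_n(F) = a_n(f) + q·a_{n/q}(f)` then `{∞, s}_F = {∞, s}_f + {∞, q s}_f` for every `s`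
(`q`-expansion principle; `{∞, s}_{ι_q f} = q⁻¹{∞, q s}_f`). [cite: CremonaAlgorithms1997, §2.4] -/
theorem modularSymbol_oldLine {N₁ : ℕ} [NeZero N₁] (q : ℕ) [NeZero q] (f : CuspForm (Gamma0 N₁) 2)
    (F : CuspForm (Gamma0 (N₁ * q)) 2)
    (hF : ∀ n : ℕ, cuspCoeff F n = cuspCoeff f n + (q : ℂ) * (if q ∣ n then cuspCoeff f (n / q) else 0)) (s : ℚ) :
    modularSymbol F s = modularSymbol f s + modularSymbol f ((q : ℚ) * s) := by
  haveI : NeZero (N₁ * q) := ⟨mul_ne_zero (NeZero.ne N₁) (NeZero.ne q)⟩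
  have hFe : F = toLevel0 (dvd_mul_right N₁ q) 2 f + (q : ℂ) • iota N₁ (N₁ * q) q 2 dvd_rfl f := by
    refine eq_of_forall_cuspCoeff_eq_gamma0 fun n ↦ ?_
    rw [hF n]
    simp only [cuspCoeff, qExpansion_coeff_add_level0, qExpansion_toLevel0, qExpansion_coeff_smul, qExpansion_coeff_iota]
  have hq0 : (q : ℂ) ≠ 0 := by exact_mod_cast NeZero.ne q
  rw [hFe, modularSymbol_add, modularSymbol_const_smul, modularSymbol_toLevel0,
    modularSymbol_iota, ← mul_assoc, mul_inv_cancel₀ hq0, one_mul]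

end Summit.BirchSwinnertonDyer.BirchSwinnertonDyer.Theorems.AlignedTransportAtTwoKilfordCopyCrossLevelTools

end
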